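import Mathlib.Analysis.InnerProductSpace.PiL2
import Mathlib.Geometry.Manifold.Instances.Real
import Mathlib.Analysis.SpecialFunctions.Pow.Real
import Mathlib.Analysis.SpecialFunctions.Sqrt
import Literature.Geometry.Lorentzian.KerrSchild
import Literature.Geometry.Lorentzian.Einstein
import HarnessLib

/-!
# The Kerr–de Sitter family in a chart regular across the event and the cosmological horizon

Family `gr`; definition request `defn-KerrDeSitterData` / `defn-KerrDeSitterBackground` of route
`route-FinalStateConjecture-LambdaRegulator` (items `UniformKdSCapture`, `PunctureTheorem`).

We realise the Kerr–de Sitter metrics `g_{M,a,Λ}` (Carter 1968: `Ric(g) = Λ g`) explicitly on the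
Kerr–Schild chart domains `Kerr.region a r₀ = {r > max r₀ 0} ⊆ E4` of `KerrSchild.lean`, in
*Cartesian star-coordinates* `(t*, x, y, z)` whose level sets `{t* = c}` are spacelike and which
are regular across **both** the future event horizon `𝓗⁺ = {r = r₊}` and the future cosmological
horizon `𝓒⁺ = {r = r_c}` (ingoing at `r₊`, outgoing at `r_c`), as in Hintz–Vasy, Acta Math. 220
(2018), §3.1–3.2 and Petersen–Vasy, arXiv:2112.01355, §1.1, and such that **`Λ = 0` is exactly the
ingoing Kerr–Schild chart of `KerrSchild.lean`** (`KerrDeSitter.bilin M a 0 = Kerr.bilin M a`,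
`bilin_zero_lambda`).

## The chart

Start from Carter's Boyer–Lindquist form (signature `(−,+,+,+)`, `λ = Λ/3`, `Ξ = 1 + λa²`,
`Δ_r = (r² + a²)(1 − λr²) − 2Mr`, `Δ_θ = 1 + λa² cos²θ`, `ρ² = r² + a² cos²θ`)
`g = ρ²(dr²/Δ_r + dθ²/Δ_θ) + (Δ_θ sin²θ/(Ξ²ρ²))(a dt − (r²+a²) dφ)² − (Δ_r/(Ξ²ρ²))(dt − a sin²θ dφ)²`
(Carter 1968; Gibbons–Lü–Page–Pope 2005, §2; Akcay–Matzner 2011, (14); Petersen–Vasy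
arXiv:2112.01355, (1.4)) and pass to `t* = t − F(r)`, `φ* = φ − P(r)` with
`F' = Ξ(r²+a²) f/Δ_r`, `P' = Ξ a f/Δ_r` for a real-analytic `f` (Petersen–Vasy (1.6)–(1.7)); this
gives the Petersen–Vasy form ((1.8) loc. cit.)
`g = ρ²(1−f²)/Δ_r dr² − (2f/Ξ)(dt* − a sin²θ dφ*) dr − (Δ_r/(Ξ²ρ²))(dt* − a sin²θ dφ*)²`
`    + (Δ_θ sin²θ/(Ξ²ρ²))(a dt* − (r²+a²) dφ*)² + ρ² dθ²/Δ_θ`,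
which is analytic across every zero of `Δ_r` at which `f = ∓1` (and `(1 − f²)/Δ_r` is analytic);
`f(r₊) = −1` makes the chart cross the *future* event horizon, `f(r_c) = +1` the *future*
cosmological horizon, and `{t* = c}` is spacelike iff `(1 − f²)(r²+a²)²/Δ_r > a² sin²θ/Δ_θ`
(Petersen–Vasy, Remark 1.1). Both sources leave `f` non-explicit (cut-offs / "many analytic
choices"); for a definition we fix the explicit algebraic choice
`f = α/√R`, `α = p − n`, `R = α² + (1 − p − n)·C`, `C = p + n + 1/(1 + p)`,
`p = λ(r²+a²)/Ξ` (de Sitter potential), `n = 2Mr/(Ξ(r²+a²))` (mass potential),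
for which `Δ_r = Ξ(r²+a²)(1 − p − n)`, `(1 − f²)/Δ_r = C/(Ξ(r²+a²)R)` is manifestly analytic and
positive, `f = −1`/`+1` automatically at the zeros of `Δ_r` where `α < 0`/`α > 0` (the de Sitter
potential enters with the outgoing, the mass potential with the ingoing sign), `Λ = 0` gives
`f = −2Mr/(r²+a²)`, `C/(Ξ(r²+a²)R) = (r²+a²+2Mr)/(r²+a²)²`, i.e. the Kerr-star slicing
`t* = v − r` of `KerrSchild.lean`, and `r → ∞` gives `f ∼ √λ r`, i.e. slices asymptotic to the flat
(cosmological) de Sitter slicing with lapse `→ Ξ^{-1/2}`. Finally the Cartesian coordinates are the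
oblate spheroidal ones of the Kerr–Schild chart, `x + iy = √(r²+a²) sin θ e^{iφ*}`, `z = r cos θ`,
so that `r = Kerr.radius a`, `dt* − a sin²θ dφ* = dt* − a σ/(r²+a²)` with `σ = x dy − y dx`,
`dr = (r(x dx + y dy) + (r²+a²) z dz/r)/ρ²`, `ρ² = r² + a²z²/r²`, and the angular part becomes
`(1/Δ_θ)(δ − ρ² dr²/(r²+a²)) + c_σ σ² + (Δ_θ a² sin²θ/(Ξ²ρ²)) dt*² − (Δ_θ a/(Ξ²ρ²))(dt* σ + σ dt*)`
(`angularBilin`; the Cartesian rewriting of `ρ² dθ²/Δ_θ + (Δ_θ sin²θ/(Ξ²ρ²))(a dt* − (r²+a²)dφ*)²`,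
smooth on the axis as in Hintz–Vasy, proof of (3.15)). At `Λ = 0` all of this collapses to
`η + 2H ℓ ⊗ ℓ` with the null covector `ℓ = (dt* − aσ/(r²+a²)) + ρ² dr/(r²+a²)` of `KerrSchild.lean`
(`Kerr.nullCovector_eq`, `bilin_zero_lambda`).

## Contents (namespace `Literature.Geometry.Lorentzian.KerrDeSitter`)

* radial functions `xi`, `delta`, `cosmoPotential`, `massPotential`, `auxC`, `tiltNormSq`, `tilt`,
  `radialCoeff`, `lapseFn`; point functions `rhoSq`, `sinSq`, `deltaTheta`; the covectors
  `E4.sigma`, `drCovector`, `omegaCovector`; `spatialDelta`, `angularBilin`, **`bilin`** (the metric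
  components), `timeVector` (`−g♯(dt*)`);
* the parameter predicate `IsRegular M a Λ r₀` (the algebraic conditions `R > 0`, `Q > Ξ²a²` on
  `{r > max r₀ 0}` under which the formulas are the Kerr–de Sitter metric with spacelike
  `t*`-slices; `isRegular_zero_lambda` : at `Λ = 0` it reduces to `0 ≤ M`), the horizon radii
  `rCosmo`, `rPlus`, `rMinus` and `IsSubextremal`;
* named facts (D-0014): analyticity of `bilin`/`timeVector`, Lorentzian signature
  (`isLorentzian_bilin`), `bilin_timeVector` (`g(T, ·) = −dt*`), the Einstein equation
  `isEinsteinVacuum` (`Ric = Λ g`, Carter 1968), bundled in the `Prop`-class `KerrDeSitter.Facts`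
  (house pattern `Kerr.Facts`); the bundled `metric`, `timeOrientation`, `spacetime`;
* proved API: symmetry, the `Λ = 0` reductions `bilin_zero_lambda : bilin M a 0 x = Kerr.bilin M a x`
  and `timeVector_zero_lambda`, `isRegular_zero_lambda`.

The induced data on `{t* = 0}` and the capture distance live in `KerrDeSitterData.lean`; the
`ModelBackground` packaging (`⟨Kerr.region a r₀, bilin M a Λ, (· 0), Kerr.radius a⟩`) is the
definition request `defn-KerrDeSitterBackground`.

## Design choices

* **Total definitions, hypotheses on the bundled objects.** All component formulas are total in
  `(M, a, Λ, x)` (junk where a radicand is negative or a denominator vanishes: `Real.sqrt`, `x/0 = 0`);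
  the region where they *are* the Kerr–de Sitter metric is described by `IsRegular M a Λ r₀`, an
  explicit semialgebraic condition taken as the hypothesis of `metric`/`timeOrientation`/`spacetime`
  (as `0 ≤ M` is for `Kerr.timeOrientation`). It holds for `Λ = 0`, `M ≥ 0` (proved) and, e.g., for
  `0 ≤ Λ`, `ΛM² ≤ 1/20`, `a² ≤ M²`, `r₀ ≥ M/100` (checked numerically, `defn-KerrDeSitterData` evidence;
  not needed for the definitions). The construction degenerates (as it must: no analytic slicing
  is both ingoing at `r₊` and outgoing at `r_c` uniformly up to the Nariai limit) for `ΛM²` close to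
  the Nariai bound `1/9`.
* **Why not Kerr–Schild on de Sitter.** The Kerr–Schild form `g = ḡ_dS + (2Mr/ρ²) k ⊗ k`
  (Gibbons–Lü–Page–Pope 2005) with the ingoing principal null congruence `k` is regular across
  `𝓗⁺` and the *past* cosmological horizon `𝓒⁻` (its `r > r_c` part is the contracting region),
  with the outgoing one across `𝓗⁻` and `𝓒⁺`; the initial value problems of Hintz–Vasy/Fang need
  `𝓗⁺` and `𝓒⁺`, which no single Kerr–Schild form covers.
* **Horizon radii** are the relevant roots of the quartic `Δ_r`, defined by `sSup`/`sInf`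
  (noncomputable, junk outside the subextremal range); nothing below depends on them.

## References

* B. Carter, *Hamilton–Jacobi and Schrödinger separable solutions of Einstein's equations*,
  Comm. Math. Phys. 10 (1968) 280–310.
* G. W. Gibbons, H. Lü, D. N. Page, C. N. Pope, *The general Kerr–de Sitter metrics in all
  dimensions*, J. Geom. Phys. 53 (2005) 49–73, §2.
* S. Akcay, R. A. Matzner, *The Kerr–de Sitter universe*, CQG 28 (2011) 085012.
* P. Hintz, A. Vasy, *The global non-linear stability of the Kerr–de Sitter family of black holes*,
  Acta Math. 220 (2018), §3.1 (Lemma 3.1: the `|dt*| = const` slicing of Schwarzschild–de Sitter),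
  §3.2 ((3.13)–(3.15): star coordinates, regularity across the horizons and on the axis).
* O. Petersen, A. Vasy, *Wave equations in the Kerr–de Sitter spacetime: the full subextremal
  range*, arXiv:2112.01355, §1.1, (1.4)–(1.8) and Remark 1.1.
* A. J. Fang, *Nonlinear stability of the slowly-rotating Kerr–de Sitter family*, arXiv:2112.07183.
-/

noncomputable section

open Bundle TopologicalSpace
open scoped Manifold ContDiff Topology

namespace Literature.Geometry.Lorentzian

/-! ### Two more Cartesian covectors -/

namespace E4

/-- The **rotational covector** `σ = x dy − y dx` (components `(0, −y, x, 0)`), i.e.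
`σ = (r² + a²) sin²θ dφ*` in the oblate spheroidal coordinates of the Kerr–Schild chart; it is
smooth on all of `E4` and vanishes on the axis. Hintz–Vasy 2018, proof of (3.15)
(`∂_{φ*} = x∂_y − y∂_x`). [cite: HintzVasy2018, §3.2 (3.15)] -/
def sigma (x : E4) : E4 →L[ℝ] ℝ := covector ![0, -(x 2), x 1, 0]

/-- `σ(v) = x v² − y v¹` (Hintz–Vasy 2018, §3.2). [cite: HintzVasy2018, §3.2] -/
@[simp]
theorem sigma_apply (x v : E4) : sigma x v = x 1 * v 2 - x 2 * v 1 := by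
  simp [sigma, Fin.sum_univ_four]
  ring

/-- The **spatial Euclidean form** `δ = ∑ᵢ dxⁱ ⊗ dxⁱ` (`i = 1, 2, 3`) on `E4`, so that
`η = −dt* ⊗ dt* + δ` (O'Neill 1983, Ch. 3, p. 55). [cite: ONeill1983, Ch. 3 p. 55] -/
def spatialDelta : E4 →L[ℝ] E4 →L[ℝ] ℝ := ∑ i : Fin 3, tmul (dx i.succ) (dx i.succ)

/-- `δ(v, w) = ∑ᵢ vⁱ wⁱ` (O'Neill 1983, Ch. 3, p. 55). [cite: ONeill1983, Ch. 3 p. 55] -/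
@[simp]
theorem spatialDelta_apply (v w : E4) : spatialDelta v w = ∑ i : Fin 3, v i.succ * w i.succ := by
  simp [spatialDelta]

end E4

namespace KerrDeSitter

/-! ### Radial functions of the Kerr–de Sitter family -/

/-- `Ξ = 1 + Λa²/3` (Carter 1968; Petersen–Vasy arXiv:2112.01355, (1.5): `b`). [cite: PetersenVasy2021, (1.5)] -/
def xi (a Λ : ℝ) : ℝ := 1 + Λ / 3 * a ^ 2

/-- `Δ_r = (r² + a²)(1 − Λr²/3) − 2Mr`, the horizon function of Kerr–de Sitter (its positive zeros
are the Cauchy, event and cosmological horizon radii). Carter 1968; Petersen–Vasy arXiv:2112.01355,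
(1.1) (`μ`); Hintz–Vasy 2018, (3.11) (`μ̃_b`). [cite: PetersenVasy2021, (1.1)] -/
def delta (M a Λ r : ℝ) : ℝ := (r ^ 2 + a ^ 2) * (1 - Λ / 3 * r ^ 2) - 2 * M * r

/-- The **de Sitter potential** `p = (Λ/3)(r² + a²)/Ξ` (so that `Δ_r = Ξ(r²+a²)(1 − p − n)`,
`delta_eq`). Gibbons–Lü–Page–Pope 2005, §2 (`1 − λr²` factor of the de Sitter background). [cite: GibbonsEtAl2004, §2] -/
def cosmoPotential (a Λ r : ℝ) : ℝ := Λ / 3 * (r ^ 2 + a ^ 2) / xi a Λ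

/-- The **mass potential** `n = 2Mr/(Ξ(r² + a²))` (the Kerr–Schild scalar `2Mr/ρ²` of
Gibbons–Lü–Page–Pope 2005, (2.x), with `ρ²` replaced by `Ξ(r²+a²)`; `Δ_r = Ξ(r²+a²)(1 − p − n)`). [cite: GibbonsEtAl2004, §2] -/
def massPotential (M a Λ r : ℝ) : ℝ := 2 * M * r / (xi a Λ * (r ^ 2 + a ^ 2))

/-- The auxiliary positive function `C = p + n + 1/(1 + p)` of the slicing (our explicit choice;
`C = 1 + 2Mr/(r²+a²)` at `Λ = 0`). See the module docstring. [folklore] -/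
def auxC (M a Λ r : ℝ) : ℝ :=
  cosmoPotential a Λ r + massPotential M a Λ r + 1 / (1 + cosmoPotential a Λ r)

/-- The radicand `R = (p − n)² + (1 − p − n)·C` of the tilt function (our explicit choice; `R = 1`
at `Λ = 0`, `tiltNormSq_zero_lambda`). See the module docstring. [folklore] -/
def tiltNormSq (M a Λ r : ℝ) : ℝ :=
  (cosmoPotential a Λ r - massPotential M a Λ r) ^ 2 +
    (1 - cosmoPotential a Λ r - massPotential M a Λ r) * auxC M a Λ r

/-- The **tilt function** `f = (p − n)/√R` of the star coordinates `t* = t − F`, `φ* = φ − P`,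
`F' = Ξ(r²+a²) f/Δ_r`, `P' = Ξ a f/Δ_r` (Petersen–Vasy arXiv:2112.01355, (1.6)–(1.7), with the
explicit `f` of the module docstring): `f = ∓1` at the zeros of `Δ_r` with `p − n ≶ 0`, and
`f = −2Mr/(r² + a²)` at `Λ = 0` (`tilt_zero_lambda`, the Kerr-star slicing). Junk value `0` where
`R ≤ 0`. [cite: PetersenVasy2021, (1.6)–(1.7)] -/
def tilt (M a Λ r : ℝ) : ℝ :=
  (cosmoPotential a Λ r - massPotential M a Λ r) / √(tiltNormSq M a Λ r)

/-- The **radial coefficient** `q̂ = (1 − f²)/Δ_r = C/(Ξ(r²+a²)R)` (the coefficient of `ρ² dr²` in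
the Petersen–Vasy form (1.8); the second expression is the manifestly regular one and is the
definition). [cite: PetersenVasy2021, (1.8)] -/
def radialCoeff (M a Λ r : ℝ) : ℝ := auxC M a Λ r / (xi a Λ * (r ^ 2 + a ^ 2) * tiltNormSq M a Λ r)

/-- The **lapse function** `Q = Ξ²(r²+a²)² q̂ = Ξ(r²+a²) C/R`, in terms of which
`ρ² g^{t*t*} = −Q + Ξ²a² sin²θ/Δ_θ`; the `t*`-slices are spacelike iff `Q > Ξ² a² sin²θ/Δ_θ`
(Petersen–Vasy arXiv:2112.01355, Remark 1.1, (1.9)). [cite: PetersenVasy2021, Remark 1.1] -/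
def lapseFn (M a Λ r : ℝ) : ℝ := xi a Λ * (r ^ 2 + a ^ 2) * auxC M a Λ r / tiltNormSq M a Λ r

/-- `Ξ = 1` at `Λ = 0` (Carter 1968). [cite: Carter1968] -/
@[simp]
theorem xi_zero_lambda (a : ℝ) : xi a 0 = 1 := by simp [xi]

/-- `Ξ ≥ 1 > 0` for `Λ ≥ 0` (Carter 1968). [cite: Carter1968] -/
theorem xi_pos {Λ : ℝ} (hΛ : 0 ≤ Λ) (a : ℝ) : 0 < xi a Λ := by
  unfold xi; positivity

/-- `Δ_r = r² − 2Mr + a²` (Kerr's `Δ`) at `Λ = 0` (Carter 1968). [cite: Carter1968] -/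
@[simp]
theorem delta_zero_lambda (M a r : ℝ) : delta M a 0 r = r ^ 2 - 2 * M * r + a ^ 2 := by
  simp [delta]; ring

/-- The de Sitter potential vanishes at `Λ = 0` (Gibbons–Lü–Page–Pope 2005, §2). [cite: GibbonsEtAl2004, §2] -/
@[simp]
theorem cosmoPotential_zero_lambda (a r : ℝ) : cosmoPotential a 0 r = 0 := by
  simp [cosmoPotential]

/-- The mass potential is `2Mr/(r² + a²)` at `Λ = 0` (Gibbons–Lü–Page–Pope 2005, §2). [cite: GibbonsEtAl2004, §2] -/
@[simp]
theorem massPotential_zero_lambda (M a r : ℝ) :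
    massPotential M a 0 r = 2 * M * r / (r ^ 2 + a ^ 2) := by
  simp [massPotential]

/-- `Δ_r = Ξ(r² + a²)(1 − p − n)` for `Λ ≥ 0` (the factorisation behind the regularity of the
chart; Gibbons–Lü–Page–Pope 2005, §2: `Δ_r = (r²+a²)(1 − λr²) − 2Mr`). [cite: GibbonsEtAl2004, §2] -/
theorem delta_eq {Λ : ℝ} (hΛ : 0 ≤ Λ) (M a : ℝ) {r : ℝ} (hr : r ^ 2 + a ^ 2 ≠ 0) :
    delta M a Λ r =
      xi a Λ * (r ^ 2 + a ^ 2) * (1 - cosmoPotential a Λ r - massPotential M a Λ r) := by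
  have hx : xi a Λ ≠ 0 := (xi_pos hΛ a).ne'
  unfold delta cosmoPotential massPotential
  field_simp
  unfold xi
  ring

/-- `C = 1 + 2Mr/(r²+a²)` at `Λ = 0`. [folklore] -/
@[simp]
theorem auxC_zero_lambda (M a r : ℝ) : auxC M a 0 r = 1 + 2 * M * r / (r ^ 2 + a ^ 2) := by
  simp [auxC]; ring

/-- `R = 1` at `Λ = 0`. [folklore] -/
@[simp]
theorem tiltNormSq_zero_lambda (M a r : ℝ) : tiltNormSq M a 0 r = 1 := by
  simp [tiltNormSq]; ring

/-- At `Λ = 0` the tilt is the Kerr-star one, `f = −2Mr/(r² + a²)` (`t* = v − r`;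
Dafermos–Rodnianski arXiv:0811.0354, §5.1). [cite: arXiv08110354, §5.1] -/
@[simp]
theorem tilt_zero_lambda (M a r : ℝ) : tilt M a 0 r = -(2 * M * r / (r ^ 2 + a ^ 2)) := by
  simp [tilt]

/-- At `Λ = 0` the radial coefficient is the Kerr–Schild one, `(r² + a² + 2Mr)/(r² + a²)²`
(Cook 2000, §3.2.2). [cite: Cook2000, §3.2.2] -/
theorem radialCoeff_zero_lambda (M a : ℝ) {r : ℝ} (hr : r ^ 2 + a ^ 2 ≠ 0) :
    radialCoeff M a 0 r = (r ^ 2 + a ^ 2 + 2 * M * r) / (r ^ 2 + a ^ 2) ^ 2 := by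
  simp [radialCoeff]
  field_simp

/-- At `Λ = 0` the lapse function is `r² + a² + 2Mr` (Cook 2000, §3.2.2: `α⁻² = 1 + 2H`). [cite: Cook2000, §3.2.2] -/
theorem lapseFn_zero_lambda (M a : ℝ) {r : ℝ} (hr : r ^ 2 + a ^ 2 ≠ 0) :
    lapseFn M a 0 r = r ^ 2 + a ^ 2 + 2 * M * r := by
  simp [lapseFn]
  field_simp

/-- The identity `f² + q̂ Δ_r = 1` (i.e. `q̂ = (1 − f²)/Δ_r`, Petersen–Vasy (1.8)), valid
wherever `R > 0`, `Λ ≥ 0`, `r² + a² ≠ 0`. [cite: PetersenVasy2021, (1.8)] -/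
theorem tilt_sq_add {M a Λ r : ℝ} (hΛ : 0 ≤ Λ) (hr : r ^ 2 + a ^ 2 ≠ 0)
    (hR : 0 < tiltNormSq M a Λ r) :
    tilt M a Λ r ^ 2 + radialCoeff M a Λ r * delta M a Λ r = 1 := by
  have hx : xi a Λ ≠ 0 := (xi_pos hΛ a).ne'
  have hs : √(tiltNormSq M a Λ r) ^ 2 = tiltNormSq M a Λ r := Real.sq_sqrt hR.le
  have hs0 : √(tiltNormSq M a Λ r) ≠ 0 := (Real.sqrt_pos.2 hR).ne'
  rw [delta_eq hΛ M a hr]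
  unfold tilt radialCoeff
  rw [div_pow, hs]
  unfold tiltNormSq at *
  field_simp

/-! ### Point functions and covectors of the Cartesian chart -/

/-- `ρ² = r² + a² cos²θ = r² + a²z²/r²` with `r = Kerr.radius a x`, `cos θ = z/r`
(`Kerr.scalarH = Mr/ρ²`). Visser arXiv:0706.0622, (33). [cite: arXiv07060622, (33)] -/
def rhoSq (a : ℝ) (x : E4) : ℝ := Kerr.radius a x ^ 2 + a ^ 2 * x 3 ^ 2 / Kerr.radius a x ^ 2

/-- `sin²θ = 1 − z²/r²` (`cos θ = z/r` in the oblate spheroidal coordinates of the Kerr–Schild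
chart). Visser arXiv:0706.0622, §5. [cite: arXiv07060622, §5] -/
def sinSq (a : ℝ) (x : E4) : ℝ := 1 - x 3 ^ 2 / Kerr.radius a x ^ 2

/-- `Δ_θ = 1 + (Λa²/3) cos²θ = 1 + Λa²z²/(3r²)` (Carter 1968; Petersen–Vasy (1.5): `c(θ)`). [cite: PetersenVasy2021, (1.5)] -/
def deltaTheta (a Λ : ℝ) (x : E4) : ℝ := 1 + Λ / 3 * a ^ 2 * x 3 ^ 2 / Kerr.radius a x ^ 2

/-- `ρ² > 0` wherever `r > 0` (Visser arXiv:0706.0622, (33)). [cite: arXiv07060622, (33)] -/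
theorem rhoSq_pos (a : ℝ) {x : E4} (hx : 0 < Kerr.radius a x) : 0 < rhoSq a x := by
  unfold rhoSq; positivity

/-- `Δ_θ ≥ 1 > 0` for `Λ ≥ 0` (Carter 1968). [cite: Carter1968] -/
theorem deltaTheta_pos (a : ℝ) {Λ : ℝ} (hΛ : 0 ≤ Λ) (x : E4) : 0 < deltaTheta a Λ x := by
  unfold deltaTheta; positivity

/-- `Δ_θ = 1` at `Λ = 0` (Carter 1968). [cite: Carter1968] -/
@[simp]
theorem deltaTheta_zero_lambda (a : ℝ) (x : E4) : deltaTheta a 0 x = 1 := by simp [deltaTheta]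

/-- `ρ² = (r⁴ + a²z²)/r²`, so that `Kerr.scalarH M a x = M r/ρ²` (Visser arXiv:0706.0622, (33)). [cite: arXiv07060622, (33)] -/
theorem scalarH_eq (M a : ℝ) {x : E4} (hx : 0 < Kerr.radius a x) :
    Kerr.scalarH M a x = M * Kerr.radius a x / rhoSq a x := by
  unfold Kerr.scalarH rhoSq
  have hr : Kerr.radius a x ≠ 0 := hx.ne'
  field_simp

/-- The **radial covector** `dr = (r(x dx + y dy) + (r² + a²) z dz/r)/ρ²` of the Kerr–Schild
radius `r = Kerr.radius a` (differentiate the quartic `r⁴ − (|x̲|² − a²)r² − a²z² = 0`; the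
components are `(0, r x/ρ², r y/ρ², (r²+a²) z/(r ρ²))`). Visser arXiv:0706.0622, (35);
Hintz–Vasy 2018, §3.2 (`∂_r = |p|⁻¹ p∂_p` at `a = 0`). [cite: arXiv07060622, (35)] -/
def drCovector (a : ℝ) (x : E4) : E4 →L[ℝ] ℝ :=
  E4.covector ![0, Kerr.radius a x * x 1 / rhoSq a x, Kerr.radius a x * x 2 / rhoSq a x,
    (Kerr.radius a x ^ 2 + a ^ 2) * x 3 / (Kerr.radius a x * rhoSq a x)]

/-- Components of `dr` (Visser arXiv:0706.0622, (35)). [cite: arXiv07060622, (35)] -/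
@[simp]
theorem drCovector_apply (a : ℝ) (x v : E4) :
    drCovector a x v = Kerr.radius a x * x 1 / rhoSq a x * v 1 +
      Kerr.radius a x * x 2 / rhoSq a x * v 2 +
      (Kerr.radius a x ^ 2 + a ^ 2) * x 3 / (Kerr.radius a x * rhoSq a x) * v 3 := by
  simp [drCovector, Fin.sum_univ_four]

/-- The covector `ω = dt* − a sin²θ dφ* = dt* − a σ/(r² + a²)` (Petersen–Vasy (1.8); together with
`dr` it spans the `(t, r)`-block of the metric; `ω + ρ² dr/(r²+a²)` is the Kerr–Schild null covector
`ℓ`, `Kerr.nullCovector_eq`). [cite: PetersenVasy2021, (1.8)] -/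
def omegaCovector (a : ℝ) (x : E4) : E4 →L[ℝ] ℝ :=
  E4.dx 0 - (a / (Kerr.radius a x ^ 2 + a ^ 2)) • E4.sigma x

/-- Components of `ω` (Petersen–Vasy (1.8)). [cite: PetersenVasy2021, (1.8)] -/
@[simp]
theorem omegaCovector_apply (a : ℝ) (x v : E4) :
    omegaCovector a x v = v 0 - a / (Kerr.radius a x ^ 2 + a ^ 2) * (x 1 * v 2 - x 2 * v 1) := by
  simp [omegaCovector]

/-- The Kerr–Schild null covector is `ℓ = ω + ρ² dr/(r² + a²)` wherever `r > 0`: in components,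
`(1, (rx + ay)/(r²+a²), (ry − ax)/(r²+a²), z/r)`. Kerr–Schild 1965; Visser arXiv:0706.0622, (34). [cite: arXiv07060622, (34)] -/
theorem _root_.Literature.Geometry.Lorentzian.Kerr.nullCovector_eq (a : ℝ) {x : E4}
    (hx : 0 < Kerr.radius a x) :
    Kerr.nullCovector a x =
      omegaCovector a x + (rhoSq a x / (Kerr.radius a x ^ 2 + a ^ 2)) • drCovector a x := by
  have hr : Kerr.radius a x ≠ 0 := hx.ne'
  have hρ : rhoSq a x ≠ 0 := (rhoSq_pos a hx).ne'
  have hra : Kerr.radius a x ^ 2 + a ^ 2 ≠ 0 := by positivity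
  ext v
  simp [Kerr.nullCovector, Kerr.nullCovectorFun, Fin.sum_univ_four]
  field_simp
  ring

/-- The coefficient `c_σ` of `σ ⊗ σ` in the Cartesian form of the angular part of the metric:
`c_σ = −a²/(Δ_θ(r²+a²)²) + a²(1 − Λr²/3)(Δ_θ(r²+a²) + Ξρ²)/(Ξ²ρ²Δ_θ(r²+a²)²)`
(`= a²/(ρ²(r²+a²))` at `Λ = 0`). Hintz–Vasy 2018, proof of (3.15) (the correction
`(κ_b² − (1+λ_b)²)∂_θ²` rewritten on the axis). [cite: HintzVasy2018, §3.2 (3.15)] -/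
def sigmaCoeff (a Λ : ℝ) (x : E4) : ℝ :=
  -(a ^ 2 / (deltaTheta a Λ x * (Kerr.radius a x ^ 2 + a ^ 2) ^ 2)) +
    a ^ 2 * (1 - Λ / 3 * Kerr.radius a x ^ 2) *
        (deltaTheta a Λ x * (Kerr.radius a x ^ 2 + a ^ 2) + xi a Λ * rhoSq a x) /
      (xi a Λ ^ 2 * rhoSq a x * deltaTheta a Λ x * (Kerr.radius a x ^ 2 + a ^ 2) ^ 2)

/-- The **angular part** `ρ² dθ²/Δ_θ + (Δ_θ sin²θ/(Ξ²ρ²))(a dt* − (r²+a²) dφ*)²` of the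
Kerr–de Sitter metric in Cartesian form:
`(1/Δ_θ)(δ − ρ² dr ⊗ dr/(r²+a²)) + c_σ σ ⊗ σ + (Δ_θ a² sin²θ/(Ξ²ρ²)) dt* ⊗ dt*`
`  − (Δ_θ a/(Ξ²ρ²))(dt* ⊗ σ + σ ⊗ dt*)`,
using `ρ²(dθ² + sin²θ dφ*²) = δ − ρ² dr²/(r²+a²) − a²σ²/(r²+a²)²` (flat metric in oblate
spheroidal coordinates) and `(r²+a²) sin²θ dφ* = σ`. Hintz–Vasy 2018, §3.2, (3.15) and its proof
(smoothness on the axis); Petersen–Vasy (1.8). [cite: HintzVasy2018, §3.2 (3.15)] -/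
def angularBilin (a Λ : ℝ) (x : E4) : E4 →L[ℝ] E4 →L[ℝ] ℝ :=
  (deltaTheta a Λ x)⁻¹ •
      (E4.spatialDelta -
        (rhoSq a x / (Kerr.radius a x ^ 2 + a ^ 2)) • E4.tmul (drCovector a x) (drCovector a x)) +
    sigmaCoeff a Λ x • E4.tmul (E4.sigma x) (E4.sigma x) +
    (deltaTheta a Λ x * a ^ 2 * sinSq a x / (xi a Λ ^ 2 * rhoSq a x)) •
      E4.tmul (E4.dx 0) (E4.dx 0) -
    (deltaTheta a Λ x * a / (xi a Λ ^ 2 * rhoSq a x)) •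
      (E4.tmul (E4.dx 0) (E4.sigma x) + E4.tmul (E4.sigma x) (E4.dx 0))

/-- The **Kerr–de Sitter metric `g_{M,a,Λ}` at the point `x`** in the Cartesian star-chart
(module docstring), as a continuous bilinear form on `E4`:
`g = −(Δ_r/(Ξ²ρ²)) ω ⊗ ω − (f/Ξ)(ω ⊗ dr + dr ⊗ ω) + ρ² q̂ dr ⊗ dr + angularBilin`,
the Cartesian transcription of Petersen–Vasy arXiv:2112.01355, (1.8) (= Hintz–Vasy 2018, (3.13))
with the explicit tilt `f = tilt M a Λ r`, `r = Kerr.radius a x`. For `Λ = 0` it is the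
Kerr–Schild form `Kerr.bilin M a x` (`bilin_zero_lambda`); for `M = 0` it is de Sitter space, for
`a = 0` Schwarzschild–de Sitter. Carter 1968 (the metric); it solves `Ric = Λ g`
(`isEinsteinVacuum`). [cite: PetersenVasy2021, (1.8)] -/
def bilin (M a Λ : ℝ) (x : E4) : E4 →L[ℝ] E4 →L[ℝ] ℝ :=
  (-(delta M a Λ (Kerr.radius a x) / (xi a Λ ^ 2 * rhoSq a x))) •
      E4.tmul (omegaCovector a x) (omegaCovector a x) -
    (tilt M a Λ (Kerr.radius a x) / xi a Λ) •
      (E4.tmul (omegaCovector a x) (drCovector a x) + E4.tmul (drCovector a x) (omegaCovector a x)) +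
    (rhoSq a x * radialCoeff M a Λ (Kerr.radius a x)) • E4.tmul (drCovector a x) (drCovector a x) +
    angularBilin a Λ x

/-- Unfolding lemma for the angular part in terms of `dr(v)`, `σ(v)`, `v⁰` and `δ(v, w)`
(Hintz–Vasy 2018, (3.15)). [cite: HintzVasy2018, §3.2 (3.15)] -/
theorem angularBilin_apply (a Λ : ℝ) (x v w : E4) :
    angularBilin a Λ x v w =
      (deltaTheta a Λ x)⁻¹ *
          (E4.spatialDelta v w -
            rhoSq a x / (Kerr.radius a x ^ 2 + a ^ 2) * (drCovector a x v * drCovector a x w)) +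
        sigmaCoeff a Λ x * (E4.sigma x v * E4.sigma x w) +
        deltaTheta a Λ x * a ^ 2 * sinSq a x / (xi a Λ ^ 2 * rhoSq a x) * (v 0 * w 0) -
        deltaTheta a Λ x * a / (xi a Λ ^ 2 * rhoSq a x) * (v 0 * E4.sigma x w + E4.sigma x v * w 0) :=
  rfl

/-- The angular part is symmetric (Carter 1968). [cite: Carter1968] -/
theorem angularBilin_symm (a Λ : ℝ) (x v w : E4) : angularBilin a Λ x v w = angularBilin a Λ x w v := by
  rw [angularBilin_apply, angularBilin_apply]
  have hδ : E4.spatialDelta v w = E4.spatialDelta w v := by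
    simp only [E4.spatialDelta_apply]; exact Finset.sum_congr rfl fun i _ ↦ mul_comm _ _
  rw [hδ]
  ring

/-- Unfolding lemma for the Kerr–de Sitter metric in terms of `ω(v)`, `dr(v)` and the angular part
(Petersen–Vasy (1.8)). [cite: PetersenVasy2021, (1.8)] -/
theorem bilin_apply (M a Λ : ℝ) (x v w : E4) :
    bilin M a Λ x v w =
      -(delta M a Λ (Kerr.radius a x) / (xi a Λ ^ 2 * rhoSq a x)) *
          (omegaCovector a x v * omegaCovector a x w) -
        tilt M a Λ (Kerr.radius a x) / xi a Λ *
          (omegaCovector a x v * drCovector a x w + drCovector a x v * omegaCovector a x w) +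
        rhoSq a x * radialCoeff M a Λ (Kerr.radius a x) * (drCovector a x v * drCovector a x w) +
        angularBilin a Λ x v w :=
  rfl

/-- The Kerr–de Sitter metric is symmetric (Carter 1968). [cite: Carter1968] -/
theorem bilin_symm (M a Λ : ℝ) (x v w : E4) : bilin M a Λ x v w = bilin M a Λ x w v := by
  rw [bilin_apply, bilin_apply, angularBilin_symm a Λ x v w]
  ring

/-! ### `Λ = 0`: the Kerr–Schild chart -/

/-- `η` in the spheroidal frame: `η = −((r²+a²)/ρ²) ω ⊗ ω + (ρ²/(r²+a²)) dr ⊗ dr + angularBilin a 0`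
wherever `r > 0` (flat space and Minkowski time in oblate spheroidal coordinates; only the
definition `ρ² = r² + a²z²/r²` is used), stated on vectors `v, w`. O'Neill 1983, Ch. 3, p. 55;
Visser arXiv:0706.0622, §5. [cite: arXiv07060622, §5] -/
theorem minkowski_bilin_eq_frame (a : ℝ) {x : E4} (hx : 0 < Kerr.radius a x) (v w : E4) :
    Minkowski.bilin v w =
      -((Kerr.radius a x ^ 2 + a ^ 2) / rhoSq a x) * (omegaCovector a x v * omegaCovector a x w) +
        rhoSq a x / (Kerr.radius a x ^ 2 + a ^ 2) * (drCovector a x v * drCovector a x w) +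
        angularBilin a 0 x v w := by
  have hr : Kerr.radius a x ≠ 0 := hx.ne'
  have hρ : rhoSq a x ≠ 0 := (rhoSq_pos a hx).ne'
  have hra : Kerr.radius a x ^ 2 + a ^ 2 ≠ 0 := by positivity
  rw [angularBilin_apply, Minkowski.bilin_apply, E4.spatialDelta_apply, omegaCovector_apply,
    omegaCovector_apply, drCovector_apply, drCovector_apply, E4.sigma_apply, E4.sigma_apply]
  simp only [sigmaCoeff, sinSq, deltaTheta_zero_lambda, xi_zero_lambda, Fin.sum_univ_three,
    Fin.succ_zero_eq_one, Fin.succ_one_eq_two, Fin.reduceSucc, inv_one, one_mul, one_pow, mul_one]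
  simp only [rhoSq] at hρ ⊢
  field_simp
  ring

/-- The Kerr–Schild null covector on vectors: `ℓ(v) = ω(v) + ρ² dr(v)/(r² + a²)` wherever `r > 0`
(Visser arXiv:0706.0622, (34)). [cite: arXiv07060622, (34)] -/
theorem _root_.Literature.Geometry.Lorentzian.Kerr.nullCovector_apply_eq (a : ℝ) {x : E4}
    (hx : 0 < Kerr.radius a x) (v : E4) :
    Kerr.nullCovector a x v =
      omegaCovector a x v + rhoSq a x / (Kerr.radius a x ^ 2 + a ^ 2) * drCovector a x v := by
  rw [Kerr.nullCovector_eq a hx]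
  rfl

/-- **At `Λ = 0` the Kerr–de Sitter chart is the ingoing Kerr–Schild chart**:
`KerrDeSitter.bilin M a 0 x = Kerr.bilin M a x = η + 2H ℓ ⊗ ℓ` wherever `r > 0` (for all real
`M, a`). Dafermos–Rodnianski arXiv:0811.0354, §5.1 (Kerr-star = Kerr–Schild time, `t* = v − r`);
Visser arXiv:0706.0622, (32)–(35). [cite: arXiv07060622, (32)–(35)] -/
theorem bilin_zero_lambda (M a : ℝ) {x : E4} (hx : 0 < Kerr.radius a x) :
    bilin M a 0 x = Kerr.bilin M a x := by
  have hr : Kerr.radius a x ≠ 0 := hx.ne'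
  have hρ : rhoSq a x ≠ 0 := (rhoSq_pos a hx).ne'
  have hra : Kerr.radius a x ^ 2 + a ^ 2 ≠ 0 := by positivity
  refine ContinuousLinearMap.ext fun v ↦ ContinuousLinearMap.ext fun w ↦ ?_
  rw [bilin_apply, Kerr.bilin_apply, minkowski_bilin_eq_frame a hx v w,
    Kerr.nullCovector_apply_eq a hx v, Kerr.nullCovector_apply_eq a hx w, scalarH_eq M a hx,
    radialCoeff_zero_lambda M a hra, tilt_zero_lambda, delta_zero_lambda, xi_zero_lambda]
  simp only [rhoSq] at hρ ⊢
  field_simp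
  ring

/-! ### The time vector `−g♯(dt*)` -/

/-- The vector field `T = −g♯(dt*)` of the Kerr–de Sitter chart, in Cartesian components
`T = (1/ρ²)[(Ξ²q̂(r²+a²)² − Ξ²a² sin²θ/Δ_θ) ∂_{t*} + (Ξ²q̂(r²+a²)a − Ξ²a/Δ_θ)(x∂_y − y∂_x)`
`      + Ξ f (r²+a²) ∂_r]`, `∂_r = (r x/(r²+a²), r y/(r²+a²), z/r)`
(from the dual metric `ρ² G = −Ξ²q̂ W² − Ξ f (∂_r W + W ∂_r) + Δ_r ∂_r² + Ξ²(a sin²θ∂_{t*} + ∂_{φ*})²/(Δ_θ sin²θ) + Δ_θ ∂_θ²`,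
`W = (r²+a²)∂_{t*} + a∂_{φ*}`, Hintz–Vasy 2018, (3.14)). It satisfies `g(T, ·) = −dt*`
(`bilin_timeVector`) and `g(T, T) = −(Q − Ξ²a² sin²θ/Δ_θ)/ρ² < 0` under `IsRegular`; at `Λ = 0`
it is `Kerr.timeVector` (`timeVector_zero_lambda`). [cite: HintzVasy2018, §3.2 (3.14)] -/
def timeVector (M a Λ : ℝ) (x : E4) : E4 :=
  let r := Kerr.radius a x
  let c₀ := (xi a Λ ^ 2 * radialCoeff M a Λ r * (r ^ 2 + a ^ 2) ^ 2 -
      xi a Λ ^ 2 * a ^ 2 * sinSq a x / deltaTheta a Λ x) / rhoSq a x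
  let c₁ := (xi a Λ ^ 2 * radialCoeff M a Λ r * (r ^ 2 + a ^ 2) * a -
      xi a Λ ^ 2 * a / deltaTheta a Λ x) / rhoSq a x
  let c₂ := xi a Λ * tilt M a Λ r * (r ^ 2 + a ^ 2) / rhoSq a x
  WithLp.toLp 2 ![c₀, -(c₁ * x 2) + c₂ * (r * x 1 / (r ^ 2 + a ^ 2)),
    c₁ * x 1 + c₂ * (r * x 2 / (r ^ 2 + a ^ 2)), c₂ * (x 3 / r)]

/-- At `Λ = 0` the time vector is the Kerr–Schild one, `T = (1 + 2H, −2H ℓ⃗) = Kerr.timeVector`,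
wherever `r > 0` (Dafermos–Rodnianski arXiv:0811.0354, §5.1). [cite: arXiv08110354, §5.1] -/
theorem timeVector_zero_lambda (M a : ℝ) {x : E4} (hx : 0 < Kerr.radius a x) :
    timeVector M a 0 x = Kerr.timeVector M a x := by
  have hr : Kerr.radius a x ≠ 0 := hx.ne'
  have hρ : rhoSq a x ≠ 0 := (rhoSq_pos a hx).ne'
  have hra : Kerr.radius a x ^ 2 + a ^ 2 ≠ 0 := by positivity
  have hH := scalarH_eq M a hx
  simp only [rhoSq] at hρ
  ext i
  fin_cases i
  · simp [timeVector, Kerr.timeVector, Kerr.nullVector, Kerr.nullCovectorFun,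
      radialCoeff_zero_lambda M a hra, hH, sinSq, rhoSq]
    field_simp
    ring
  · simp [timeVector, Kerr.timeVector, Kerr.nullVector, Kerr.nullCovectorFun,
      radialCoeff_zero_lambda M a hra, hH, rhoSq]
    field_simp
    ring
  · simp [timeVector, Kerr.timeVector, Kerr.nullVector, Kerr.nullCovectorFun,
      radialCoeff_zero_lambda M a hra, hH, rhoSq]
    field_simp
    ring
  · simp [timeVector, Kerr.timeVector, Kerr.nullVector, Kerr.nullCovectorFun, hH, rhoSq]
    field_simp

/-! ### Parameter ranges, horizon radii -/

/-- The parameters `(M, a, Λ, r₀)` are **regular** for the star-chart: `0 ≤ Λ` and, for every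
`r > max r₀ 0`, the radicand `R` of the tilt is positive and the lapse function satisfies
`Q > Ξ² a²` (so that the formulas of this file are analytic on `Kerr.region a r₀`, are the
Kerr–de Sitter metric there, and the slices `{t* = c}` are spacelike: `ρ² g^{t*t*} = −Q + Ξ²a²sin²θ/Δ_θ`,
Petersen–Vasy, Remark 1.1). A semialgebraic hypothesis predicate (like `0 ≤ M` for
`Kerr.timeOrientation`), not a named fact: at `Λ = 0` it reduces to `−max r₀ 0 ≤ 2M`
(`isRegular_zero_lambda_iff`), it holds e.g. for `ΛM² ≤ 1/20`, `a² ≤ M²`, `r₀ ≥ M/100` (numerical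
evidence on the work item), and it fails near the Nariai bound `ΛM² = 1/9`. [cite: PetersenVasy2021, Remark 1.1] -/
def IsRegular (M a Λ r₀ : ℝ) : Prop :=
  0 ≤ Λ ∧ ∀ r : ℝ, max r₀ 0 < r → 0 < tiltNormSq M a Λ r ∧ xi a Λ ^ 2 * a ^ 2 < lapseFn M a Λ r

/-- Regular parameters have `Λ ≥ 0`. [folklore] -/
theorem IsRegular.lambda_nonneg {M a Λ r₀ : ℝ} (h : IsRegular M a Λ r₀) : 0 ≤ Λ := h.1

/-- Regular parameters have `R > 0` on `{r > max r₀ 0}`. [folklore] -/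
theorem IsRegular.tiltNormSq_pos {M a Λ r₀ : ℝ} (h : IsRegular M a Λ r₀) {r : ℝ}
    (hr : max r₀ 0 < r) : 0 < tiltNormSq M a Λ r := (h.2 r hr).1

/-- Regular parameters have `Q > Ξ²a²` on `{r > max r₀ 0}`. [folklore] -/
theorem IsRegular.lt_lapseFn {M a Λ r₀ : ℝ} (h : IsRegular M a Λ r₀) {r : ℝ}
    (hr : max r₀ 0 < r) : xi a Λ ^ 2 * a ^ 2 < lapseFn M a Λ r := (h.2 r hr).2

/-- Regularity is inherited by smaller chart domains (larger inner radius). [folklore] -/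
theorem IsRegular.mono {M a Λ r₀ r₀' : ℝ} (h : IsRegular M a Λ r₀) (hle : r₀ ≤ r₀') :
    IsRegular M a Λ r₀' :=
  ⟨h.1, fun r hr ↦ h.2 r ((max_le_max hle le_rfl).trans_lt hr)⟩

/-- **At `Λ = 0` the regularity condition is `−max r₀ 0 ≤ 2M`** (`R = 1`, `Q = r² + a² + 2Mr`):
in particular it holds for all `M ≥ 0` and every `a, r₀`, the hypothesis of `Kerr.timeOrientation`.
Dafermos–Rodnianski arXiv:0811.0354, §5.1 (`∇t*` is timelike on `{r > 0}` for `M ≥ 0`). [cite: arXiv08110354, §5.1] -/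
theorem isRegular_zero_lambda_iff (M a r₀ : ℝ) : IsRegular M a 0 r₀ ↔ -max r₀ 0 ≤ 2 * M := by
  constructor
  · rintro ⟨-, h⟩
    by_contra hlt
    have hlt : 2 * M < -max r₀ 0 := lt_of_not_ge hlt
    -- `r = (max r₀ 0 - 2M) / 2 > max r₀ 0` since `-max r₀ 0 > 2M`, and then `Q(r) = r (r + 2M) + a² …`
    set m := max r₀ 0 with hm
    have hm0 : 0 ≤ m := le_max_right _ _
    have hr : m < (m - 2 * M) / 2 := by linarith
    obtain ⟨-, hQ⟩ := h ((m - 2 * M) / 2) hr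
    have hpos : 0 < (m - 2 * M) / 2 := hm0.trans_lt hr
    have hra : ((m - 2 * M) / 2) ^ 2 + a ^ 2 ≠ 0 := by positivity
    rw [lapseFn_zero_lambda M a hra, xi_zero_lambda] at hQ
    nlinarith
  · intro hM
    refine ⟨le_rfl, fun r hr ↦ ⟨by simp, ?_⟩⟩
    have hr0 : 0 < r := (le_max_right r₀ 0).trans_lt hr
    have hra : r ^ 2 + a ^ 2 ≠ 0 := by positivity
    rw [lapseFn_zero_lambda M a hra, xi_zero_lambda]
    nlinarith [le_max_right r₀ 0]

/-- For `M ≥ 0` the Kerr–Schild chart (`Λ = 0`) is regular for every `a, r₀`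
(Dafermos–Rodnianski arXiv:0811.0354, §5.1). [cite: arXiv08110354, §5.1] -/
theorem isRegular_zero_lambda {M : ℝ} (hM : 0 ≤ M) (a r₀ : ℝ) : IsRegular M a 0 r₀ :=
  (isRegular_zero_lambda_iff M a r₀).2 (by linarith [le_max_right r₀ 0])

/-- The **cosmological horizon radius** `r_c`: the largest zero of `Δ_r`, realised as
`sSup {r | 0 < Δ_r(r)}` (for `Λ > 0` this set is bounded above since `Δ_r → −∞`). Junk value
(Mathlib's `sSup` of an unbounded set, `0`) for `Λ ≤ 0`. Gibbons–Hawking 1977; Akcay–Matzner 2011,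
§3; Petersen–Vasy arXiv:2112.01355, (1.2). [cite: PetersenVasy2021, (1.2)] -/
def rCosmo (M a Λ : ℝ) : ℝ := sSup {r | 0 < delta M a Λ r}

/-- The **event horizon radius** `r₊`: the largest `r` below `r_c` at which `Δ_r ≤ 0`, realised as
`sSup {r | r < r_c ∧ Δ_r(r) ≤ 0}` (for subextremal parameters `Δ_r > 0` exactly on `(r₊, r_c)`
among `r > r₋`). Junk outside the black-hole range (e.g. for `M = 0` there is no such `r > 0`).
Akcay–Matzner 2011, §3; Petersen–Vasy arXiv:2112.01355, (1.2)–(1.3). [cite: PetersenVasy2021, (1.2)–(1.3)] -/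
def rPlus (M a Λ : ℝ) : ℝ := sSup {r | r < rCosmo M a Λ ∧ delta M a Λ r ≤ 0}

/-- The **Cauchy (inner) horizon radius** `r₋`: the infimum of the positive `r` with `Δ_r ≤ 0`,
`sInf {r | 0 < r ∧ Δ_r(r) ≤ 0}` (`= 0` for `a = 0`, as `Kerr.rMinus M 0`). Akcay–Matzner 2011, §3. [cite: AkcayMatzner2011, §3] -/
def rMinus (M a Λ : ℝ) : ℝ := sInf {r | 0 < r ∧ delta M a Λ r ≤ 0}

/-- The Kerr–de Sitter parameters are **subextremal** (non-degenerate): `M > 0`, `Λ > 0` and the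
horizon function `Δ_r` has three distinct positive simple zeros `r₋ < r₊ < r_c` (for `a = 0`:
`0 = r₋ < r₊ < r_c`, i.e. `9ΛM² < 1`), with `Δ_r < 0` on `(r₋, r₊)` and beyond `r_c`, `Δ_r > 0` on
`(r₊, r_c)`. Stated through the sign pattern of `Δ_r` at the radii `rMinus`, `rPlus`, `rCosmo`.
Petersen–Vasy arXiv:2112.01355, (1.2)–(1.3); Hintz–Vasy 2018, Lemma 3.3 and Remark 3.6;
Akcay–Matzner 2011, §3. [cite: PetersenVasy2021, (1.2)–(1.3)] -/
def IsSubextremal (M a Λ : ℝ) : Prop :=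
  0 < M ∧ 0 < Λ ∧ rMinus M a Λ < rPlus M a Λ ∧ rPlus M a Λ < rCosmo M a Λ ∧
    delta M a Λ (rPlus M a Λ) = 0 ∧ delta M a Λ (rCosmo M a Λ) = 0 ∧
    (∀ r ∈ Set.Ioo (rMinus M a Λ) (rPlus M a Λ), delta M a Λ r < 0) ∧
    (∀ r ∈ Set.Ioo (rPlus M a Λ) (rCosmo M a Λ), 0 < delta M a Λ r) ∧
    ∀ r, rCosmo M a Λ < r → delta M a Λ r < 0

/-! ### Named facts and the bundled metric -/

/-- The section `x ↦ g_{M,a,Λ}(x)` of the bundle of bilinear forms on `T(Kerr.region a r₀)` is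
real-analytic, for regular parameters (`r` is analytic and positive on `{r > 0}`; `R > 0`, `ρ²`,
`Ξ`, `Δ_θ`, `r² + a²` do not vanish there). Hintz–Vasy 2018, Prop. 3.5 and (3.15) (smoothness of
`g_b` on `M°`, including the axis); Petersen–Vasy arXiv:2112.01355, §1.1 (real-analyticity).
Named fact (D-0014), a field of `KerrDeSitter.Facts`. [cite: HintzVasy2018, Prop. 3.5] -/
def contMDiff_bilin (M a Λ r₀ : ℝ) : Prop :=
  IsRegular M a Λ r₀ →
    ContMDiff 𝓘(ℝ, E4) (𝓘(ℝ, E4).prod 𝓘(ℝ, E4 →L[ℝ] E4 →L[ℝ] ℝ)) ω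
      (fun x : Kerr.region a r₀ ↦ TotalSpace.mk' (E4 →L[ℝ] E4 →L[ℝ] ℝ)
        (E := fun y : Kerr.region a r₀ ↦
          TangentSpace 𝓘(ℝ, E4) y →L[ℝ] TangentSpace 𝓘(ℝ, E4) y →L[ℝ] ℝ)
        x (bilin M a Λ x.1))

/-- For regular parameters, `g_{M,a,Λ}(x)` is a **nondegenerate Lorentzian** scalar product at
every point of `Kerr.region a r₀`: nondegenerate (its determinant is `−ρ⁴ sin²θ/Ξ⁴` in star
coordinates, Hintz–Vasy 2018, below (3.13)), with a timelike vector (`timeVector`, cf.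
`bilin_timeVector`) whose orthogonal complement is spacelike (signature `(1, 3)`, Hintz–Vasy 2018,
Prop. 3.5/3.9). A null coframe for the `(t, r)`-block is `X = (1+f)ω/(Ξρ²) − q̂ dr`,
`Y = (1−f)ω/(Ξq̂) + ρ² dr` (`−X·Y` is that block). Named fact (D-0014), a field of
`KerrDeSitter.Facts`. [cite: HintzVasy2018, Prop. 3.5] -/
def isLorentzian_bilin (M a Λ r₀ : ℝ) : Prop :=
  IsRegular M a Λ r₀ → ∀ x ∈ Kerr.region a r₀,
    (∀ v : E4, (∀ w, bilin M a Λ x v w = 0) → v = 0) ∧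
      (∃ v : E4, bilin M a Λ x v v < 0) ∧
      ∀ v w : E4, bilin M a Λ x v v < 0 → bilin M a Λ x v w = 0 → w ≠ 0 → 0 < bilin M a Λ x w w

/-- `g(T, w) = −dt*(w) = −w⁰` for `T = KerrDeSitter.timeVector` wherever `r > 0` and `R > 0`,
`Λ ≥ 0` (in particular on `Kerr.region a r₀` for regular parameters): `T` is `−g♯(dt*)`
(Hintz–Vasy 2018, (3.14), the dual metric). Consequently `g(T, T) = −T⁰ = −(Q − Ξ²a²sin²θ/Δ_θ)/ρ²`.
Named fact (D-0014; a rational identity in the chart functions), a field of `KerrDeSitter.Facts`. [cite: HintzVasy2018, §3.2 (3.14)] -/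
def bilin_timeVector (M a Λ : ℝ) : Prop :=
  0 ≤ Λ → ∀ x : E4, 0 < Kerr.radius a x → 0 < tiltNormSq M a Λ (Kerr.radius a x) →
    ∀ w : E4, bilin M a Λ x (timeVector M a Λ x) w = -w 0

/-- The vector field `x ↦ T(x) = −g♯(dt*)` is a real-analytic section of `T(Kerr.region a r₀)`
for regular parameters (its components are rational in `(x, r, √R)`). Hintz–Vasy 2018, Prop. 3.5
(smooth dependence of `G_b`, hence of `G_b(dt*, ·)`). Named fact (D-0014), a field of
`KerrDeSitter.Facts`. [cite: HintzVasy2018, Prop. 3.5] -/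
def contMDiff_timeVector (M a Λ r₀ : ℝ) : Prop :=
  IsRegular M a Λ r₀ →
    ContMDiff 𝓘(ℝ, E4) 𝓘(ℝ, E4).tangent ω
      (fun x : Kerr.region a r₀ ↦
        (TotalSpace.mk' E4 x (timeVector M a Λ x.1) : TangentBundle 𝓘(ℝ, E4) (Kerr.region a r₀)))

/-- The analytic and algebraic facts about the Kerr–de Sitter star-chart that are vendored as
named facts (D-0014) and on which the bundled objects depend: analyticity of `x ↦ g(x)` and of
`x ↦ T(x)` (Hintz–Vasy 2018, Prop. 3.5), Lorentzian signature (ibid.), and `g(T, ·) = −dt*`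
(ibid., (3.14)). A `Prop`-valued class taken as the instance hypothesis `[KerrDeSitter.Facts]`
(house pattern `Kerr.Facts`) by `metric`, `timeOrientation`, `spacetime` and the data of
`KerrDeSitterData.lean`. [cite: HintzVasy2018, Prop. 3.5 and (3.14)] -/
class Facts : Prop where
  /-- `x ↦ g_{M,a,Λ}(x)` is analytic (named fact `contMDiff_bilin`). -/
  contMDiff_bilin (M a Λ r₀ : ℝ) : KerrDeSitter.contMDiff_bilin M a Λ r₀
  /-- `g_{M,a,Λ}(x)` is nondegenerate Lorentzian (named fact `isLorentzian_bilin`). -/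
  isLorentzian_bilin (M a Λ r₀ : ℝ) : KerrDeSitter.isLorentzian_bilin M a Λ r₀
  /-- `g(T, ·) = −dt*` (named fact `bilin_timeVector`). -/
  bilin_timeVector (M a Λ : ℝ) : KerrDeSitter.bilin_timeVector M a Λ
  /-- `x ↦ T(x)` is analytic (named fact `contMDiff_timeVector`). -/
  contMDiff_timeVector (M a Λ r₀ : ℝ) : KerrDeSitter.contMDiff_timeVector M a Λ r₀

/-- The **Kerr–de Sitter metric** `g_{M,a,Λ}` on the star-chart domain
`Kerr.region a r₀ = {r > max r₀ 0}` for regular parameters `h : IsRegular M a Λ r₀`, as an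
analytic Lorentzian metric (`val x = bilin M a Λ x`; analyticity and signature from
`[KerrDeSitter.Facts]`). For `Λ = 0` its values are those of `Kerr.metric M a r₀`
(`bilin_zero_lambda`). Carter 1968; Hintz–Vasy 2018, §3.2; Petersen–Vasy arXiv:2112.01355,
§1.1. [cite: Carter1968] -/
def metric [Facts] (M a Λ r₀ : ℝ) (h : IsRegular M a Λ r₀) :
    LorentzianMetric 𝓘(ℝ, E4) ω (Kerr.region a r₀) where
  val x := bilin M a Λ x.1
  symm x := bilin_symm M a Λ x.1
  nondegenerate x := (Facts.isLorentzian_bilin M a Λ r₀ h x.1 x.2).1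
  contMDiff := Facts.contMDiff_bilin M a Λ r₀ h
  exists_timelike x := (Facts.isLorentzian_bilin M a Λ r₀ h x.1 x.2).2.1
  pos_of_orthogonal x := (Facts.isLorentzian_bilin M a Λ r₀ h x.1 x.2).2.2

/-- The Kerr–de Sitter metric at `x` is `KerrDeSitter.bilin M a Λ x` (Carter 1968). [cite: Carter1968] -/
@[simp]
theorem metric_val [Facts] (M a Λ r₀ : ℝ) (h : IsRegular M a Λ r₀) (x : Kerr.region a r₀) :
    (metric M a Λ r₀ h).val x = bilin M a Λ x.1 := rfl

/-- For regular parameters the time vector is timelike on the chart domain: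
`g(T, T) = −(Q − Ξ²a² sin²θ/Δ_θ)/ρ² < 0`, from `g(T, ·) = −dt*` (instance hypothesis
`[KerrDeSitter.Facts]`) and `Q > Ξ²a² ≥ Ξ²a² sin²θ/Δ_θ`. Petersen–Vasy arXiv:2112.01355,
Remark 1.1. [cite: PetersenVasy2021, Remark 1.1] -/
theorem bilin_timeVector_timeVector_neg [Facts] {M a Λ r₀ : ℝ} (h : IsRegular M a Λ r₀) {x : E4}
    (hx : x ∈ Kerr.region a r₀) :
    bilin M a Λ x (timeVector M a Λ x) (timeVector M a Λ x) < 0 := by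
  have hr0 : 0 < Kerr.radius a x := Kerr.radius_pos_of_mem_region hx
  have hR : 0 < tiltNormSq M a Λ (Kerr.radius a x) := h.tiltNormSq_pos hx
  rw [Facts.bilin_timeVector M a Λ h.lambda_nonneg x hr0 hR]
  -- `T⁰ = (Ξ² q̂ (r²+a²)² − Ξ² a² sin²θ/Δ_θ)/ρ² = (Q − Ξ²a² sin²θ/Δ_θ)/ρ² > 0`
  have hρ : 0 < rhoSq a x := rhoSq_pos a hr0
  have hΔθ : 0 < deltaTheta a Λ x := deltaTheta_pos a h.lambda_nonneg x
  have hQ := h.lt_lapseFn hx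
  have hs : sinSq a x ≤ 1 := by
    unfold sinSq
    have : 0 ≤ x 3 ^ 2 / Kerr.radius a x ^ 2 := by positivity
    linarith
  have hΔθ1 : 1 ≤ deltaTheta a Λ x := by
    unfold deltaTheta
    have : 0 ≤ Λ / 3 * a ^ 2 * x 3 ^ 2 / Kerr.radius a x ^ 2 := by
      have := h.lambda_nonneg; positivity
    linarith
  have hT0 : timeVector M a Λ x 0 =
      (xi a Λ ^ 2 * radialCoeff M a Λ (Kerr.radius a x) * (Kerr.radius a x ^ 2 + a ^ 2) ^ 2 -
        xi a Λ ^ 2 * a ^ 2 * sinSq a x / deltaTheta a Λ x) / rhoSq a x := by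
    simp [timeVector]
  rw [hT0, neg_lt_zero]
  refine div_pos ?_ hρ
  -- `Ξ² q̂ (r²+a²)² = Q` and `Q > Ξ²a² ≥ Ξ² a² sinSq/Δ_θ`
  have hq : xi a Λ ^ 2 * radialCoeff M a Λ (Kerr.radius a x) * (Kerr.radius a x ^ 2 + a ^ 2) ^ 2 =
      lapseFn M a Λ (Kerr.radius a x) := by
    unfold radialCoeff lapseFn
    field_simp
  rw [hq]
  have h1 : xi a Λ ^ 2 * a ^ 2 * sinSq a x / deltaTheta a Λ x ≤ xi a Λ ^ 2 * a ^ 2 := by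
    rw [div_le_iff₀ hΔθ]
    have h0 : 0 ≤ xi a Λ ^ 2 * a ^ 2 := by positivity
    nlinarith
  linarith

/-- The **time orientation** of the Kerr–de Sitter star-chart for regular parameters: the analytic
timelike vector field `T = −g♯(dt*)` (future-directed in the sense `g(T, ∂_{t*}) = −1 < 0`); for
`Λ = 0` it is `Kerr.timeOrientation`'s `−g♯(dt*)` (`timeVector_zero_lambda`). Hintz–Vasy 2018,
§3.3 (`dt*` is timelike everywhere on `M`); Petersen–Vasy arXiv:2112.01355, Remark 1.1. [cite: HintzVasy2018, §3.3] -/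
def timeOrientation [Facts] (M a Λ r₀ : ℝ) (h : IsRegular M a Λ r₀) :
    TimeOrientation (metric M a Λ r₀ h) where
  vectorField x := timeVector M a Λ x.1
  isTimelike x := bilin_timeVector_timeVector_neg h x.2
  contMDiff := Facts.contMDiff_timeVector M a Λ r₀ h

/-- The **Kerr–de Sitter spacetime** `(Kerr.region a r₀, g_{M,a,Λ})` for regular parameters, on
the star-chart domain `{r > max r₀ 0}` (regular across the future event and cosmological horizons
for subextremal parameters and `r₋ < r₀ < r₊`), time-oriented by `−g♯(dt*)`, as a bundled
`Spacetime 4` (connected by the named fact `Kerr.isConnected_region`, instance hypothesis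
`[Kerr.Facts]`). Carter 1968; Hintz–Vasy 2018, §3.2 (`M° = ℝ_{t*} × X`). [cite: HintzVasy2018, §3.2] -/
def spacetime [Kerr.Facts] [Facts] (M a Λ r₀ : ℝ) (h : IsRegular M a Λ r₀) : Spacetime 4 where
  carrier := Kerr.region a r₀
  connectedSpace := Kerr.connectedSpace_region a r₀
  metric := (metric M a Λ r₀ h).ofLE le_top
  timeOrientation := (timeOrientation M a Λ r₀ h).ofLE le_top

/-- The carrier of the Kerr–de Sitter spacetime is the chart domain `Kerr.region a r₀`
(Hintz–Vasy 2018, §3.2). [cite: HintzVasy2018, §3.2] -/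
theorem spacetime_carrier [Kerr.Facts] [Facts] (M a Λ r₀ : ℝ) (h : IsRegular M a Λ r₀) :
    (spacetime M a Λ r₀ h).carrier = Kerr.region a r₀ := rfl

/-! ### The Einstein equation -/

/-- The Kerr–de Sitter metric solves the **Einstein vacuum equations with cosmological constant
`Λ`**, `Ric(g) = Λ g`, on the whole chart domain, for regular parameters. Carter 1968, §(5)–(6)
(the `Λ`-term solutions); Gibbons–Lü–Page–Pope 2005, §2; Akcay–Matzner 2011, §2. Named fact
(D-0014); it binds the standing hypothesis `[(metric …).HasLeviCivita]` of the curvature API, as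
`Kerr.isRicciFlat` does. [cite: Carter1968] -/
def isEinsteinVacuum [Facts] (M a Λ r₀ : ℝ) : Prop :=
  ∀ (h : IsRegular M a Λ r₀) [(metric M a Λ r₀ h).HasLeviCivita],
    (metric M a Λ r₀ h).toPseudoRiemannianMetric.IsEinsteinVacuum Λ

end KerrDeSitter

end Literature.Geometry.Lorentzian

end
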